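import Summits.Ventures.CertifiedArithmetic.Expansions.IncircleStageCBounds
import Summits.Ventures.CertifiedArithmetic.Expansions.IncircleStageCMargins
import Summits.Ventures.CertifiedArithmetic.Expansions.Orient3dStageCMargins
import Summits.Ventures.CertifiedArithmetic.Expansions.IncircleStageB
import Summits.Ventures.CertifiedArithmetic.Expansions.ExpansionGrids
import Mathlib.Tactic.Linarith
import Mathlib.Tactic.Positivity
import Mathlib.Tactic.Ring
import Mathlib.Tactic.NormNum

/-!
# INCIRCLE, stage C of `incircleadapt`: the model, its grids, the early exit

NEW WORK in the sense of this development (the algorithm is Shewchuk's `incircleadapt`, file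
`predicates.c`; the model over `ℚ`, statements and proofs are ours; nothing here is cited anywhere
as a literature fact).  This file holds the MODEL of stage C (`incircleStageC`), the grid
fact for stage B's `fin1` (`incircleB_onGrid`) and the soundness of the EARLY EXIT
(`incircleStageB_estimate_sign_of_tails`); the soundness of the stage-C TEST is
`IncircleStageC.lean`, its unconditional instances `IncircleStageCCorrect.lean`.

THE OBJECT.  After stage B (`IncircleStageB`: `fin1`, `det = estimate(fin1)`, test against
`iccerrboundB ⊗ permanent`) the C code computes the six TWO-DIFF-TAILs
`adxtail = (a₁ − d₁) − adx, …`, returns `det` if all of them vanish, and otherwise sets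
`errbound = iccerrboundC ⊗ permanent ⊕ resulterrbound ⊗ |det|`,
`detadd = ((adx ⊗ adx ⊕ ady ⊗ ady) ⊗ ((bdx ⊗ cdytail ⊕ cdy ⊗ bdxtail)`
`                                     ⊖ (bdy ⊗ cdxtail ⊕ cdx ⊗ bdytail))`
`          ⊕ (2 ⊗ (adx ⊗ adxtail ⊕ ady ⊗ adytail)) ⊗ (bdx ⊗ cdy ⊖ bdy ⊗ cdx)) ⊕ (… b …) ⊕ (… c …)`,
`det ⊕= detadd`, and returns `det` if `det ≥ errbound` or `−det ≥ errbound` (else stage D).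
`incircleStageC` below is this computation over a rounding `fl` and a two-product `tp`
(`some det` = stage C answers, `none` = fall through), with two liberties, both exact: the tails
are written as the exact roundoffs `(a₁ − d₁) − adx` (this IS what TWO-DIFF-TAIL returns,
`twoDiff_exact`), and in the factors `bdx ⊗ cdy ⊖ bdy ⊗ cdx`, `cdx ⊗ ady ⊖ cdy ⊗ adx`,
`adx ⊗ bdy ⊖ bdx ⊗ ady` the products are written in stage A's operand order (`cdx ⊗ bdy`,
`adx ⊗ cdy`, `bdx ⊗ ady`) — the same floats (the rational products agree before rounding), which
makes all six products literally the six products of stage A; likewise the three lifts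
`adx ⊗ adx ⊕ ady ⊗ ady, …` are literally stage A's `alift, blift, clift`.  The doubling `2 ⊗ x` IS
kept as a rounded operation of the model; the proof shows it is exact (`fl_eq_self`,
`isFloat_two_mul`).  The early exit "all tails zero ⇒ return `det`" is not a branch of
`incircleStageC`; it is justified separately (`incircleStageB_estimate_sign_of_tails`).

References: J. R. Shewchuk, Discrete Comput. Geom. 18 (1997) 305–363, §4.4, Fig. 24–25, Table 4;
`predicates.c` (public domain), routine `incircleadapt` [Shewchuk1997].
-/

namespace Summit.Ventures.CertifiedArithmetic.Expansions

open Literature.ComputerArithmetic.JeannerodRump2018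
open Literature.ComputerArithmetic.BoldoJeannerodMelquiondMuller2023 hiding twoSum twoSum_fst
  isFloat_twoSum
open Literature.ComputerArithmetic.Shewchuk1997
open Literature.ComputerArithmetic.GraillatLefevreMuller2015 (unitRoundoff_le_of_five_le)

variable {p : ℕ} {emin : ℤ} {fl : ℚ → ℚ}

/-! ## The model of stage C -/

/-- **Stage C of `incircleadapt`** over a two-product `tp`, a rounding `fl`, coefficients `KC`
(of the permanent) and `KR` (of `|det|`) and the inherited `permanent`: with the six rounded
differences, their exact tails, `det = estimate(fin1)` of stage B,
`errbound = KC ⊗ permanent ⊕ KR ⊗ |det|` and the rounded first-order correction `detadd` (three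
terms `lift_z ⊗ ((x ⊗ yt ⊕ y' ⊗ xt') ⊖ (y ⊗ xt ⊕ x' ⊗ yt')) ⊕ (2 ⊗ (x_z ⊗ x_zt ⊕ y_z ⊗ y_zt)) ⊗
(x ⊗ y ⊖ x' ⊗ y')`, summed left to right), return `det' = det ⊕ detadd` iff `det' ≥ errbound` or
`−det' ≥ errbound`.  `some det'` = stage C answers; `none` = fall through to stage D. -/
def incircleStageC (tp : ℚ → ℚ → ℚ × ℚ) (fl : ℚ → ℚ) (KC KR permanent : ℚ)
    (a₁ a₂ b₁ b₂ c₁ c₂ d₁ d₂ : ℚ) : Option ℚ :=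
  let adx := fl (a₁ - d₁)
  let bdx := fl (b₁ - d₁)
  let cdx := fl (c₁ - d₁)
  let ady := fl (a₂ - d₂)
  let bdy := fl (b₂ - d₂)
  let cdy := fl (c₂ - d₂)
  let adxt := a₁ - d₁ - adx
  let bdxt := b₁ - d₁ - bdx
  let cdxt := c₁ - d₁ - cdx
  let adyt := a₂ - d₂ - ady
  let bdyt := b₂ - d₂ - bdy
  let cdyt := c₂ - d₂ - cdy
  let det := estimate fl (incircleB tp fl adx ady bdx bdy cdx cdy)
  let errbound := fl (fl (KC * permanent) + fl (KR * |det|))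
  let ta := fl (fl (fl (fl (adx * adx) + fl (ady * ady))
        * fl (fl (fl (bdx * cdyt) + fl (cdy * bdxt)) - fl (fl (bdy * cdxt) + fl (cdx * bdyt))))
      + fl (fl (2 * fl (fl (adx * adxt) + fl (ady * adyt))) * fl (fl (bdx * cdy) - fl (cdx * bdy))))
  let tb := fl (fl (fl (fl (bdx * bdx) + fl (bdy * bdy))
        * fl (fl (fl (cdx * adyt) + fl (ady * cdxt)) - fl (fl (cdy * adxt) + fl (adx * cdyt))))
      + fl (fl (2 * fl (fl (bdx * bdxt) + fl (bdy * bdyt))) * fl (fl (cdx * ady) - fl (adx * cdy))))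
  let tc := fl (fl (fl (fl (cdx * cdx) + fl (cdy * cdy))
        * fl (fl (fl (adx * bdyt) + fl (bdy * adxt)) - fl (fl (ady * bdxt) + fl (bdx * adyt))))
      + fl (fl (2 * fl (fl (cdx * cdxt) + fl (cdy * cdyt))) * fl (fl (adx * bdy) - fl (bdx * ady))))
  let det' := fl (det + fl (fl (ta + tb) + tc))
  if errbound ≤ det' ∨ errbound ≤ -det' then some det' else none

/-! ## Grids: `fin1` and `det = estimate(fin1)` lie on `2^4e₀ ℤ` -/

/-- Grids are closed under doubling. -/
private theorem onGrid_two_mul {s : ℤ} {a : ℚ} (h : OnGrid s a) : OnGrid s (2 * a) := by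
  obtain ⟨m, rfl⟩ := h
  exact ⟨2 * m, by push_cast; ring⟩

/-- Every component of stage B's expansion `fin1 = incircleB …` over differences in `F(p, e₀)`
lies on the grid `2^4e₀ ℤ` (the doubly scaled blocks are floats of `F(p, 4e₀)` by
`orient3dTerm_coarse` and `scaleExpansionZeroElim_coarse`, and FAST-EXPANSION-SUM-ZEROELIM keeps
grids). -/
theorem incircleB_onGrid (hp : 4 ≤ p) (hfl : IsRoundNearest p emin fl) (hfl2 : RoundoffBelow 2 fl)
    {e₀ : ℤ} (h2 : emin ≤ e₀ + e₀) (h3 : emin ≤ e₀ + e₀ + e₀) (h4 : emin ≤ e₀ + e₀ + e₀ + e₀)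
    {tp : ℚ → ℚ → ℚ × ℚ}
    (htp : ∀ x y, IsFloat p e₀ x → IsFloat p e₀ y → ExactTwoProd p emin fl tp x y)
    (htp' : ∀ x y, IsFloat p (e₀ + e₀) x → IsFloat p e₀ y → ExactTwoProd p emin fl tp x y)
    (htp'' : ∀ x y, IsFloat p (e₀ + e₀ + e₀) x → IsFloat p e₀ y → ExactTwoProd p emin fl tp x y)
    {xa ya xb yb xc yc : ℚ} (hxa : IsFloat p e₀ xa) (hya : IsFloat p e₀ ya)
    (hxb : IsFloat p e₀ xb) (hyb : IsFloat p e₀ yb) (hxc : IsFloat p e₀ xc)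
    (hyc : IsFloat p e₀ yc) :
    ∀ w ∈ incircleB tp fl xa ya xb yb xc yc, OnGrid (e₀ + e₀ + e₀ + e₀) w := by
  have hp1 : 1 ≤ p := le_trans (by norm_num) hp
  -- the doubly scaled blocks are floats of `F(p, 4e₀)`
  have GS : ∀ {a b c d z : ℚ}, IsFloat p e₀ a → IsFloat p e₀ b → IsFloat p e₀ c →
      IsFloat p e₀ d → IsFloat p e₀ z →
      ∀ w ∈ incircleScale tp fl a b c d z, IsFloat p (e₀ + e₀ + e₀ + e₀) w := by
    intro a b c d z ha hb hc hd hz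
    have G1 := orient3dTerm_coarse hp1 hfl hfl2 h2 h3 htp htp' ha hb hc hd hz
    obtain ⟨-, -, F, -, -, -⟩ :=
      incircleScale_spec hp1 hfl hfl2 h2 h3 h4 htp htp' htp'' ha hb hc hd hz
    have htpS : ∀ x ∈ orient3dTerm tp fl a b c d z,
        (tp x z).1 = fl (x * z) ∧ (tp x z).1 + (tp x z).2 = x * z := fun x hx =>
      let h := htp'' x z (G1 x hx) hz
      ⟨h.1, h.2.1⟩
    exact scaleExpansionZeroElim_coarse hp1 hfl h4 G1 hz htpS F
  -- hence the lifted cofactor terms lie on `2^4e₀ ℤ`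
  have GT : ∀ {a b c d x y : ℚ}, IsFloat p e₀ a → IsFloat p e₀ b → IsFloat p e₀ c →
      IsFloat p e₀ d → IsFloat p e₀ x → IsFloat p e₀ y →
      ∀ w ∈ incircleTerm tp fl a b c d x y, OnGrid (e₀ + e₀ + e₀ + e₀) w := by
    intro a b c d x y ha hb hc hd hx hy
    obtain ⟨-, -, F1, -, -, -⟩ :=
      incircleScale_spec hp1 hfl hfl2 h2 h3 h4 htp htp' htp'' ha hb hc hd hx
    obtain ⟨-, -, F2, -, -, -⟩ :=
      incircleScale_spec hp1 hfl hfl2 h2 h3 h4 htp htp' htp'' ha hb hc hd hy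
    exact onGrid_of_mem_fastExpansionSumZeroElim hp1 hfl h4 F1 F2
      (fun w hw => OnGrid.of_isFloat (GS ha hb hc hd hx w hw))
      (fun w hw => OnGrid.of_isFloat (GS ha hb hc hd hy w hw))
  obtain ⟨W1, -, F1, -, -, -⟩ :=
    incircleTerm_spec hp hfl hfl2 h2 h3 h4 htp htp' htp'' hxb hyc hxc hyb hxa hya
  obtain ⟨W2, -, F2, -, -, -⟩ :=
    incircleTerm_spec hp hfl hfl2 h2 h3 h4 htp htp' htp'' hxc hya hxa hyc hxb hyb
  obtain ⟨-, -, F3, -, -, -⟩ :=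
    incircleTerm_spec hp hfl hfl2 h2 h3 h4 htp htp' htp'' hxa hyb hxb hya hxc hyc
  obtain ⟨-, -, F12, -, -, -⟩ := fastExpansionSumZeroElim_spec hp hfl hfl2 F1 W1 F2 W2
  have G12 := onGrid_of_mem_fastExpansionSumZeroElim hp1 hfl h4 F1 F2
    (GT hxb hyc hxc hyb hxa hya) (GT hxc hya hxa hyc hxb hyb)
  exact onGrid_of_mem_fastExpansionSumZeroElim hp1 hfl h4 F12 F3 G12 (GT hxa hyb hxb hya hxc hyc)

/-! ## The early exit: all tails zero -/

/-- If `|a − b| ≤ δ|b|` with `δ < 1`, then `a` and `b` have the same sign (both ways, zero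
included). -/
private theorem sign_iff_of_rel_err_lt_one {a b δ : ℚ} (h : |a - b| ≤ δ * |b|) (hδ : δ < 1) :
    (0 < a ↔ 0 < b) ∧ (a < 0 ↔ b < 0) := by
  rcases lt_trichotomy b 0 with hb | rfl | hb
  · rw [abs_of_neg hb] at h
    have h1 := (abs_sub_le_iff.mp h).1
    have : a < 0 := by nlinarith
    exact ⟨⟨fun ha => absurd ha (not_lt.mpr this.le), fun hb' => absurd hb' (not_lt.mpr hb.le)⟩,
      ⟨fun _ => hb, fun _ => this⟩⟩
  · simp only [sub_zero, abs_zero, mul_zero] at h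
    have ha : a = 0 := abs_eq_zero.mp (le_antisymm h (abs_nonneg a))
    subst ha; exact ⟨Iff.rfl, Iff.rfl⟩
  · rw [abs_of_pos hb] at h
    have h1 := (abs_sub_le_iff.mp h).2
    have : 0 < a := by nlinarith
    exact ⟨⟨fun _ => hb, fun _ => this⟩,
      ⟨fun ha => absurd ha (not_lt.mpr this.le), fun hb' => absurd hb' (not_lt.mpr hb.le)⟩⟩

/-- **The early exit of stage C is sound**: if all six TWO-DIFF-TAILs vanish (the differences were
computed exactly), stage B's `det = estimate(fin1)` — which `incircleadapt` then returns — has the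
sign of the exact determinant, ZERO INCLUDED (`fin1` sums to `(9)` exactly and `estimate` is
`3ε`-accurate).  Same hypotheses as stage B's expansion (`p ≥ 4`, `emin ≤ e₀, 2e₀, 3e₀, 4e₀`). -/
theorem incircleStageB_estimate_sign_of_tails (hp : 4 ≤ p) (hfl : IsRoundNearest p emin fl)
    (hfl2 : RoundoffBelow 2 fl)
    (hest3 : ∀ ⦃l : List ℚ⦄, (∀ x ∈ l, IsFloat p emin x) → IsWeakExpansion l →
      |estimate fl l - l.sum| ≤ 3 * unitRoundoff p * |l.sum|)
    {e₀ : ℤ} (he₀ : emin ≤ e₀) (he₂ : emin ≤ e₀ + e₀) (he₃ : emin ≤ e₀ + e₀ + e₀)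
    (he₄ : emin ≤ e₀ + e₀ + e₀ + e₀) {a₁ a₂ b₁ b₂ c₁ c₂ d₁ d₂ : ℚ}
    (ha₁ : IsFloat p e₀ a₁) (ha₂ : IsFloat p e₀ a₂) (hb₁ : IsFloat p e₀ b₁)
    (hb₂ : IsFloat p e₀ b₂) (hc₁ : IsFloat p e₀ c₁) (hc₂ : IsFloat p e₀ c₂)
    (hd₁ : IsFloat p e₀ d₁) (hd₂ : IsFloat p e₀ d₂)
    {tp : ℚ → ℚ → ℚ × ℚ}
    (htp : ∀ x y, IsFloat p e₀ x → IsFloat p e₀ y → ExactTwoProd p emin fl tp x y)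
    (htp' : ∀ x y, IsFloat p (e₀ + e₀) x → IsFloat p e₀ y → ExactTwoProd p emin fl tp x y)
    (htp'' : ∀ x y, IsFloat p (e₀ + e₀ + e₀) x → IsFloat p e₀ y → ExactTwoProd p emin fl tp x y)
    (hta₁ : fl (a₁ - d₁) = a₁ - d₁) (hta₂ : fl (a₂ - d₂) = a₂ - d₂) (htb₁ : fl (b₁ - d₁) = b₁ - d₁)
    (htb₂ : fl (b₂ - d₂) = b₂ - d₂) (htc₁ : fl (c₁ - d₁) = c₁ - d₁)
    (htc₂ : fl (c₂ - d₂) = c₂ - d₂) :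
    let det := estimate fl (incircleB tp fl (fl (a₁ - d₁)) (fl (a₂ - d₂)) (fl (b₁ - d₁))
      (fl (b₂ - d₂)) (fl (c₁ - d₁)) (fl (c₂ - d₂)))
    (0 < det ↔ 0 < incircleDet a₁ a₂ b₁ b₂ c₁ c₂ d₁ d₂) ∧
      (det < 0 ↔ incircleDet a₁ a₂ b₁ b₂ c₁ c₂ d₁ d₂ < 0) := by
  intro det
  have hp1 : 1 ≤ p := le_trans (by norm_num) hp
  have hu16 : unitRoundoff p ≤ 1 / 16 :=
    Literature.ComputerArithmetic.BoldoMuller2011.unitRoundoff_le_sixteenth hp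
  have fx : ∀ {x y : ℚ}, IsFloat p e₀ x → IsFloat p e₀ y → IsFloat p e₀ (fl (x - y)) :=
    fun hx hy => isFloat_of_isFloat_of_onGrid (hfl _).1
      (((OnGrid.of_isFloat hx).sub (OnGrid.of_isFloat hy)).fl_of hp1 hfl he₀)
  obtain ⟨hW, hS, hF, -, -, -⟩ := incircleB_spec hp hfl hfl2 he₂ he₃ he₄ htp htp' htp''
    (fx ha₁ hd₁) (fx ha₂ hd₂) (fx hb₁ hd₁) (fx hb₂ hd₂) (fx hc₁ hd₁) (fx hc₂ hd₂)
  have hest := hest3 hF hW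
  have hB : incircleDetB (fl (a₁ - d₁)) (fl (a₂ - d₂)) (fl (b₁ - d₁)) (fl (b₂ - d₂)) (fl (c₁ - d₁))
      (fl (c₂ - d₂)) = incircleDet a₁ a₂ b₁ b₂ c₁ c₂ d₁ d₂ := by
    rw [hta₁, hta₂, htb₁, htb₂, htc₁, htc₂]
    unfold incircleDetB incircleDet; ring
  rw [hS, hB] at hest
  exact sign_iff_of_rel_err_lt_one hest (by linarith)

end Summit.Ventures.CertifiedArithmetic.Expansions
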